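import Summits.Ventures.CertifiedManyBodySolver.Observables.ThermalFluxZeemanOperator
import Literature.MathematicalPhysics.QuantumLattice.TwistedHoppingPlaneWaves
import Summits.HubbardSuperconductivity.HubbardSuperconductivity.Theorems.BalabanIRBirGappedPhaseReductionSectorFourier
import Literature.MathematicalPhysics.QuantumLattice.FreeFermionSpinTwistedTraceFormula
import Literature.MathematicalPhysics.QuantumLattice.HubbardNNNHoppingFluxThermal
import HarnessLib

/-!
# Free-gas (`U = 0`) sector witness for TcThermcert1's K1 family — part 2: the twisted free torus gas as `dΓ(h(θ))`,
# K1's sector block, and the spin-twisted trace formula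

(a)–(e) of the model glue: `magneticHubbardTorus_uniformTwist_eq_dGamma` (the uniformly twisted `U = 0` torus Hamiltonian IS
`dΓ(twistedOneBody L ![θ,0] 0)`), `partitionFn_toBlock_flux_free_eq_trace` (K1's `(N, S^z=0)` sector block of the seam-flux torus has
partition function `tr(𝟙_{(M,M)} e^{−β dΓ h(θ)})`, `L ≥ 3`), `trace_exp_spinTwist_mul_gibbsWeight_dGamma_twistedOneBody`
(`tr(e^{Σ_σ f_σ N_σ} e^{−β dΓ h(θ)}) = ∏_k ∏_σ (1 + e^{f_σ} e^{−β ξ_k(θ)})`, plane-wave diagonalisation on the orbitals). Technical device: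
the generic free-fermion lemmas are restated for an arbitrary `DecidableEq` instance (`…_decEq`), because the orbitals of
`FermionTorus 2 L` carry the `Lex`/`Fintype` instance rather than the order-derived one (cf. `partitionFn_dGamma_eq_det_decEq`).
HONEST FRAMING: statements about the FREE (`U = 0`) twisted torus gas and about symmetric functions of explicit reals;
nothing here touches `U = 8`; superconductivity in the Hubbard model is NOT proved (or disproved) by any of this.
Provenance: landed form of the crux workfile `Cruxes/ThermalStiffnessCeilingU8b10_le_1o8/FreeGasArcSkeleton.lean` v4.1 (tree 80a90c42bbb7)
+ `FreeGasArcInputs.lean` (d3c3c585d14e), planner `hubbard-floor-idea-rescuer` g5, card `free-gas-arc-darroch` (crit-1 KEEP);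
hubbard-floor support target ST-K1-U0-1, `--supports stmt-Ventures-26381` (TcThermcert1 crux K1). Split into ≤ 400-line modules
`Theorems/TcThermcert1FreeGas*.lean`.
-/

noncomputable section

namespace Summit.Ventures.CertifiedManyBodySolver.Theorems.FreeGasArc

open Filter Topology Set Real Finset
open Summit.Ventures.CertifiedManyBodySolver.Observables
open Literature.MathematicalPhysics.QuantumLattice
open Literature.Probability.LatticeModels (TorusSite latticeMomentum)
open scoped BigOperators

/-! ## §6 (v4, 2026-08-29) STUB 1 PROVED — the model glue, from tree theorems only

Route of the proof of `stub_sectorLogZ_free` (every step a theorem of this section; the names in brackets are the tree inputs):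
(a) seam flux ↦ uniform twist [`partitionFn_toBlock_uniformTwistTT'_eq`, `L ≥ 3`]; (b) `magneticHubbardTorus_uniformTwist_eq_dGamma`:
the uniformly twisted `U = 0` torus Hamiltonian IS `dΓ(twistedOneBody L ![θ,0] 0)` [`magneticHubbardTorus_eq`, `twistedOneBody_apply_orb`];
(c) `partitionFn_toBlock_flux_free_eq_trace`: K1's sector block has partition function `tr(𝟙_{(M,M)} e^{−β dΓ h(θ)})`
[`partitionFn_toBlock_eq_sum_diag`, sector preservation of `dΓ`]; (d)+(e) `trace_exp_spinTwist_mul_gibbsWeight_dGamma_twistedOneBody`: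
`tr(e^{Σ_σ f_σ N_σ} e^{−β dΓ h(θ)}) = ∏_k ∏_σ (1 + e^{f_σ} e^{−β ξ_k(θ)})` by plane-wave diagonalisation ON THE ORBITALS
[`twistedOneBody_eq_conj`, `planeWaveMatrix_mem_unitaryGroup`, `trace_exp_dGamma_unitary_conj_diagonal`, `Matrix.det_conj`];
(f) `sectorTrace_free_eq_esymmW_mul` / `_sq`: the double Fourier coefficient [`trace_sectorIndicator_mul_eq_integral`] factorises and
each factor is `2π e_a(w)` [`FreeGasArc.Inputs.esymmW_fourierCoeff`, shifted to `[0, 2π]` by periodicity], so `Z_{(a,b)} = e_a(w)e_b(w)`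
for EVERY spin-resolved sector `(N↑, N↓) = (a, b)`, in particular `Z_{(M,M)} = e_M(w)²`; `thermalFluxLogZ_free_eq` is the glue at any `δ`.
Technical device: the generic free-fermion lemmas are restated for an arbitrary `DecidableEq` instance (`…_decEq`), because the
orbitals of `FermionTorus 2 L` carry the `Lex`/`Fintype` instance rather than the order-derived one (cf. `partitionFn_dGamma_eq_det_decEq`). -/

section StubOneProof

open Matrix
open Literature.MathematicalPhysics.QuantumFieldTheory
open scoped ComplexConjugate

variable {L : ℕ} [NeZero L]

/-- `ofTorusSite (z + eᵢ) = shift (ofTorusSite z) i`. -/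
theorem ofTorusSite_siteShift (z : Site 2 L) (i : Fin 2) :
    FermionTorus.ofTorusSite (Site.shift z i) = FermionTorus.shift (FermionTorus.ofTorusSite z) i := by
  apply FermionTorus.equivTorusSite.injective
  change FermionTorus.toTorusSite _ = FermionTorus.toTorusSite _
  rw [FermionTorus.toTorusSite_shift, FermionTorus.toTorusSite_ofTorusSite,
    FermionTorus.toTorusSite_ofTorusSite, Site.shift]

/-- `Σ_y [x = y + eᵢ] c • T y = c • T (x − eᵢ)`. -/
theorem sum_ite_eq_shift_smul {M : Type*} [AddCommMonoid M] [Module ℂ M] (x : FermionTorus 2 L) (i : Fin 2)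
    (c : ℂ) (T : FermionTorus 2 L → M) :
    ∑ y, (if x = FermionTorus.shift y i then c • T y else 0) = c • T (FermionTorus.unshift x i) := by
  rw [Finset.sum_eq_single (FermionTorus.unshift x i)]
  · rw [if_pos (FermionTorus.shift_unshift x i).symm]
  · intro y _ hy
    rw [if_neg]
    intro h
    exact hy (by rw [h, FermionTorus.unshift_shift])
  · exact fun h => absurd (Finset.mem_univ _) h

/-- `Σ_y [y = x + eᵢ] c • T y = c • T (x + eᵢ)`. -/
theorem sum_ite_shift_eq_smul {M : Type*} [AddCommMonoid M] [Module ℂ M] (x : FermionTorus 2 L) (i : Fin 2)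
    (c : ℂ) (T : FermionTorus 2 L → M) :
    ∑ y, (if y = FermionTorus.shift x i then c • T y else 0) = c • T (FermionTorus.shift x i) := by
  rw [Finset.sum_eq_single (FermionTorus.shift x i)]
  · rw [if_pos rfl]
  · intro y _ hy
    rw [if_neg hy]
  · exact fun h => absurd (Finset.mem_univ _) h

omit [NeZero L] in
/-- The uniform-twist phase as a complex exponential. -/
theorem coe_circleExp_div (θ : ℝ) :
    ((Circle.exp (θ / L) : Circle) : ℂ) = Complex.exp (Complex.I * ((θ : ℝ) : ℂ) / (L : ℂ)) := by
  rw [Circle.coe_exp]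
  congr 1
  push_cast
  ring

omit [NeZero L] in
/-- `conj (exp (iθ/L)) = exp (−iθ/L)`. -/
theorem conj_cexp_I_mul_div (θ : ℝ) :
    conj (Complex.exp (Complex.I * ((θ : ℝ) : ℂ) / (L : ℂ))) = Complex.exp (-(Complex.I * ((θ : ℝ) : ℂ) / (L : ℂ))) := by
  rw [← Complex.exp_conj, map_div₀, map_mul, Complex.conj_I, Complex.conj_ofReal, Complex.conj_natCast, neg_mul, neg_div]

/-- Reindexing a site sum along the shift `x ↦ x + eᵢ`. -/
theorem sum_shift_reindex {M : Type*} [AddCommMonoid M] (i : Fin 2) (g : FermionTorus 2 L → FermionTorus 2 L → M) :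
    ∑ x, g x (FermionTorus.unshift x i) = ∑ x, g (FermionTorus.shift x i) x :=
  (Fintype.sum_equiv (FermionTorus.shiftEquiv i) (fun x => g (FermionTorus.shift x i) x)
    (fun x => g x (FermionTorus.unshift x i)) (fun x => by
      rw [FermionTorus.shiftEquiv_apply, FermionTorus.unshift_shift])).symm

/-- **(b) The uniformly twisted free torus Hamiltonian is `dΓ` of the boost-gauge twisted hopping matrix**:
`magneticHubbardTorus L (uniformTwistConfig L θ) 1 0 = dΓ(twistedOneBody L (θ, 0) 0)` (both put `−e^{iθ/L}` on `c†_{x+e₁,σ} c_{x,σ}`). -/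
theorem magneticHubbardTorus_uniformTwist_eq_dGamma (θ : ℝ) :
    magneticHubbardTorus L (uniformTwistConfig L θ) 1 0 = dGamma (twistedOneBody L ![θ, 0] 0) := by
  -- normal form of the right-hand side
  have hR : dGamma (twistedOneBody L ![θ, 0] 0) =
      ∑ x : FermionTorus 2 L, ∑ σ : Fin 2, ∑ i : Fin 2,
        ((-Complex.exp (Complex.I * ((![θ, 0] i : ℝ) : ℂ) / (L : ℂ))) •
            (creation (orb (FermionTorus.shift x i) σ) * annihilation (orb x σ)) +
          (-Complex.exp (-(Complex.I * ((![θ, 0] i : ℝ) : ℂ) / (L : ℂ)))) •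
            (creation (orb x σ) * annihilation (orb (FermionTorus.shift x i) σ))) := by
    rw [dGamma_eq, sum_orb_eq_sum_sum]
    simp only [sum_orb_eq_sum_sum, twistedOneBody_apply_orb, Complex.ofReal_zero, ite_self, sub_zero]
    -- collapse the spin sum and the `y`-sums
    have hσ : ∀ (x : FermionTorus 2 L) (σ : Fin 2),
        (∑ y : FermionTorus 2 L, ∑ σ' : Fin 2,
          (if σ = σ' then ∑ i : Fin 2,
            ((if x = FermionTorus.shift y i then -Complex.exp (Complex.I * ((![θ, 0] i : ℝ) : ℂ) / (L : ℂ)) else 0) +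
              (if y = FermionTorus.shift x i then -Complex.exp (-(Complex.I * ((![θ, 0] i : ℝ) : ℂ) / (L : ℂ))) else 0))
            else 0) • (creation (orb x σ) * annihilation (orb y σ'))) =
        ∑ i : Fin 2,
          ((-Complex.exp (Complex.I * ((![θ, 0] i : ℝ) : ℂ) / (L : ℂ))) •
              (creation (orb x σ) * annihilation (orb (FermionTorus.unshift x i) σ)) +
            (-Complex.exp (-(Complex.I * ((![θ, 0] i : ℝ) : ℂ) / (L : ℂ)))) •
              (creation (orb x σ) * annihilation (orb (FermionTorus.shift x i) σ))) := by
      intro x σ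
      simp only [ite_smul, zero_smul, Finset.sum_ite_eq, Finset.mem_univ, if_true, Finset.sum_smul, add_smul]
      rw [Finset.sum_comm]
      refine Finset.sum_congr rfl fun i _ => ?_
      rw [Finset.sum_add_distrib, sum_ite_eq_shift_smul, sum_ite_shift_eq_smul]
    simp only [hσ]
    rw [Finset.sum_comm]
    conv_rhs => rw [Finset.sum_comm]
    refine Finset.sum_congr rfl fun σ _ => ?_
    rw [Finset.sum_comm]
    conv_rhs => rw [Finset.sum_comm]
    refine Finset.sum_congr rfl fun i _ => ?_
    rw [Finset.sum_add_distrib, Finset.sum_add_distrib]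
    exact congrArg₂ (· + ·) (sum_shift_reindex i (fun a b =>
      (-Complex.exp (Complex.I * ((![θ, 0] i : ℝ) : ℂ) / (L : ℂ))) • (creation (orb a σ) * annihilation (orb b σ)))) rfl
  -- normal form of the left-hand side
  rw [hR, magneticHubbardTorus_eq]
  simp only [Complex.ofReal_zero, zero_smul, add_zero, Complex.ofReal_one, neg_smul, one_smul,
    ofTorusSite_siteShift, uniformTwistConfig_apply]
  rw [FermionTorus.sum_eq_sum_torusSite, ← Finset.sum_neg_distrib]
  refine Finset.sum_congr rfl fun z _ => ?_
  simp only [Fin.sum_univ_two, Fin.isValue, if_true, show ((1 : Fin 2) = 0) = False by decide, if_false,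
    Matrix.cons_val_zero, Matrix.cons_val_one, coe_circleExp_div, conj_cexp_I_mul_div,
    Circle.coe_one, map_one, one_smul, Complex.ofReal_zero, mul_zero, zero_div, neg_zero, Complex.exp_zero,
    neg_add]
  abel

/-- **(a)+(b)** `uniformTwistTT' L 0 0 θ = dΓ(twistedOneBody L (θ,0) 0)` (the `t'`-term vanishes). -/
theorem uniformTwistTT'_zero_zero_eq_dGamma (θ : ℝ) :
    uniformTwistTT' L 0 0 θ = dGamma (twistedOneBody L ![θ, 0] 0) := by
  unfold uniformTwistTT'
  rw [magneticHubbardTorus_uniformTwist_eq_dGamma]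
  simp only [Complex.ofReal_zero, neg_zero, zero_smul, add_zero]

/-- `dΓ(twistedOneBody)` conserves `(N↑, N↓)`. -/
theorem preservesSectors_dGamma_twistedOneBody (θ : ℝ) :
    PreservesSectors (dGamma (twistedOneBody L ![θ, 0] 0)) := by
  rw [← magneticHubbardTorus_uniformTwist_eq_dGamma]
  exact preservesSectors_magneticHubbardTorus _ _ _

omit [NeZero L] in
/-- **(c) K1's sector predicate is `#↑ = #↓ = M_L`.** -/
theorem sectorPred_iff_card (M : ℕ) (s : Finset (Orb (FermionTorus 2 L))) :
    (s.card = 2 * M ∧ 2 * (s.filter fun i => (ofLex i).2 = 0).card = 2 * M) ↔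
      ((upPart s).card = M ∧ (downPart s).card = M) := by
  rw [Summit.Ventures.CertifiedManyBodySolver.Observables.card_filter_spin_zero_eq_card_upPart',
    card_eq_upPart_add_downPart s]
  omega

/-- **(c) The sector partition function of the flux torus at `U = t' = 0` is the `(M, M)`-indicator trace of the free
twisted Gibbs weight** (any `M`; K1 uses `M = M_L = ⌊7L²/16⌋`). -/
theorem partitionFn_toBlock_flux_free_eq_trace (hL : 3 ≤ L) (β θ : ℝ) (M : ℕ) :
    partitionFn β ((hubbardTorusTT'Flux L 0 0 θ).toBlock
        (fun s : Finset (Orb (FermionTorus 2 L)) => s.card = 2 * M ∧ 2 * (s.filter fun i => (ofLex i).2 = 0).card = 2 * M)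
        (fun s : Finset (Orb (FermionTorus 2 L)) => s.card = 2 * M ∧ 2 * (s.filter fun i => (ofLex i).2 = 0).card = 2 * M)) =
      ((diagonal fun s : Finset (Orb (FermionTorus 2 L)) =>
          if (upPart s).card = M ∧ (downPart s).card = M then (1 : ℂ) else 0) *
        gibbsWeight β (dGamma (twistedOneBody L ![θ, 0] 0))).trace := by
  rw [← partitionFn_toBlock_uniformTwistTT'_eq hL 0 0 θ β _, uniformTwistTT'_zero_zero_eq_dGamma]
  -- the block to the complement vanishes
  have hK : (dGamma (twistedOneBody L ![θ, 0] 0)).toBlock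
      (fun s : Finset (Orb (FermionTorus 2 L)) => s.card = 2 * M ∧ 2 * (s.filter fun i => (ofLex i).2 = 0).card = 2 * M)
      (fun a => ¬ (a.card = 2 * M ∧ 2 * (a.filter fun i => (ofLex i).2 = 0).card = 2 * M)) = 0 := by
    ext a b
    rw [toBlock_apply, Matrix.zero_apply]
    by_contra hne
    have hs := preservesSectors_dGamma_twistedOneBody θ a.1 b.1 hne
    have ha : (upPart (a : Finset (Orb (FermionTorus 2 L)))).card = M ∧
        (downPart (a : Finset (Orb (FermionTorus 2 L)))).card = M := (sectorPred_iff_card M _).1 a.2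
    exact b.2 ((sectorPred_iff_card M _).2 ⟨hs.1 ▸ ha.1, hs.2 ▸ ha.2⟩)
  rw [Summit.Ventures.CertifiedManyBodySolver.Observables.partitionFn_toBlock_eq_sum_diag β _ _ hK,
    Summit.HubbardSuperconductivity.HubbardSuperconductivity.Theorems.trace_diagonal_mul_eq_sum, Finset.sum_filter]
  refine Finset.sum_congr rfl fun s _ => ?_
  rw [ite_mul, one_mul, zero_mul]
  exact if_congr (sectorPred_iff_card M s) rfl rfl

/-! ### Generic free-fermion lemmas, restated for an arbitrary `DecidableEq` instance
(the orbitals of the fermionic torus carry the `Lex`/`Fintype` instance, not the one derived from the linear order —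
same device as `partitionFn_dGamma_eq_det_decEq` in `TwistedHoppingPlaneWaves`). -/

section DecEq

/-- `trace_exp_dGamma_unitary_conj_diagonal` for an arbitrary `DecidableEq` instance on the index type. -/
theorem trace_exp_dGamma_unitary_conj_diagonal_decEq {ι : Type*} [DecidableEq ι] [LinearOrder ι] [Fintype ι]
    (U : Matrix.unitaryGroup ι ℂ) (d : ι → ℂ) :
    (NormedSpace.exp (dGamma ((U : Matrix ι ι ℂ) * diagonal d * star (U : Matrix ι ι ℂ)))).trace =
      (1 + NormedSpace.exp ((U : Matrix ι ι ℂ) * diagonal d * star (U : Matrix ι ι ℂ))).det := by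
  have e : (‹DecidableEq ι› : DecidableEq ι) = LinearOrder.toDecidableEq := Subsingleton.elim _ _
  subst e
  exact trace_exp_dGamma_unitary_conj_diagonal U d

/-- `sum_smul_spinNumber_eq_dGamma` for an arbitrary `DecidableEq` instance on the sites. -/
theorem sum_smul_spinNumber_eq_dGamma_decEq {Λ : Type*} [DecidableEq Λ] [LinearOrder Λ] [Fintype Λ] (f : Fin 2 → ℂ) :
    ∑ σ : Fin 2, f σ • ∑ x : Λ, numberAt (orb x σ) = dGamma (diagonal fun o : Orb Λ => f (ofLex o).2) := by
  have e : (‹DecidableEq Λ› : DecidableEq Λ) = LinearOrder.toDecidableEq := Subsingleton.elim _ _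
  subst e
  exact sum_smul_spinNumber_eq_dGamma f

/-- `exp_sum_smul_spinNumber_eq_diagonal` for an arbitrary `DecidableEq` instance on the sites. -/
theorem exp_sum_smul_spinNumber_eq_diagonal_decEq {Λ : Type*} [DecidableEq Λ] [LinearOrder Λ] [Fintype Λ] (f : Fin 2 → ℂ) :
    NormedSpace.exp (∑ σ : Fin 2, f σ • ∑ x : Λ, numberAt (orb x σ)) =
      diagonal fun s : Finset (Orb Λ) => Complex.exp (f 0 * (upPart s).card + f 1 * (downPart s).card) := by
  have e : (‹DecidableEq Λ› : DecidableEq Λ) = LinearOrder.toDecidableEq := Subsingleton.elim _ _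
  subst e
  exact exp_sum_smul_spinNumber_eq_diagonal f

/-- `trace_sectorIndicator_mul_eq_integral` (BalabanIR…SectorFourier) for an arbitrary `DecidableEq` instance on the sites. -/
theorem trace_sectorIndicator_mul_eq_integral_decEq {Λ : Type*} [DecidableEq Λ] [LinearOrder Λ] [Fintype Λ] (a b : ℕ)
    (X : Matrix (Finset (Orb Λ)) (Finset (Orb Λ)) ℂ) :
    ((diagonal fun s : Finset (Orb Λ) =>
        if (upPart s).card = a ∧ (downPart s).card = b then (1 : ℂ) else 0) * X).trace =
      (1 / (2 * Real.pi) ^ 2 : ℂ) *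
        ∫ φ in (0:ℝ)..2 * Real.pi, ∫ χ in (0:ℝ)..2 * Real.pi,
          Complex.exp (-((((a : ℝ) * φ + (b : ℝ) * χ : ℝ) : ℂ) * Complex.I)) *
            ((diagonal fun s : Finset (Orb Λ) =>
              Complex.exp (((((upPart s).card : ℝ) * φ + ((downPart s).card : ℝ) * χ : ℝ) : ℂ) * Complex.I)) *
                X).trace := by
  have e : (‹DecidableEq Λ› : DecidableEq Λ) = LinearOrder.toDecidableEq := Subsingleton.elim _ _
  subst e
  exact Summit.HubbardSuperconductivity.HubbardSuperconductivity.Theorems.trace_sectorIndicator_mul_eq_integral a b X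

end DecEq

/-! ### (d)+(e) The spin-twisted trace of the free twisted Gibbs weight, in closed form -/

omit [NeZero L] in
/-- A spin-diagonal matrix on the orbitals commutes with every spin-only diagonal `diag(f_{σ(o)})`. -/
theorem commute_spinDiagonal {A : Matrix (Orb (FermionTorus 2 L)) (Orb (FermionTorus 2 L)) ℂ}
    (hA : ∀ o o', (ofLex o).2 ≠ (ofLex o').2 → A o o' = 0) (f : Fin 2 → ℂ) :
    Commute (diagonal fun o : Orb (FermionTorus 2 L) => f (ofLex o).2) A := by
  change (diagonal fun o : Orb (FermionTorus 2 L) => f (ofLex o).2) * A =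
    A * diagonal fun o : Orb (FermionTorus 2 L) => f (ofLex o).2
  ext o o'
  rw [diagonal_mul, mul_diagonal]
  by_cases h : (ofLex o).2 = (ofLex o').2
  · rw [h, mul_comm]
  · rw [hA o o' h, mul_zero, zero_mul]

/-- The twisted hopping matrix is diagonal in spin. -/
theorem twistedOneBody_spin_offdiag (θ2 : Fin 2 → ℝ) (μ : ℝ) (o o' : Orb (FermionTorus 2 L))
    (h : (ofLex o).2 ≠ (ofLex o').2) : twistedOneBody L θ2 μ o o' = 0 := by
  rw [twistedOneBody, Matrix.of_apply, if_neg h, if_neg (fun e => h (by rw [e])), sub_zero]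

/-- The plane-wave matrix is diagonal in spin. -/
theorem planeWaveMatrix_spin_offdiag (o o' : Orb (FermionTorus 2 L)) (h : (ofLex o).2 ≠ (ofLex o').2) :
    planeWaveMatrix 2 L o o' = 0 := by
  simp only [planeWaveMatrix, Matrix.of_apply, planeWave, if_neg h, mul_zero]

/-- **(d)+(e) The spin-twisted trace formula for the free twisted torus gas, diagonalised by plane waves:**
`tr (exp(Σ_σ f_σ N_σ) e^{−β dΓ(h(θ))}) = ∏_k ∏_σ (1 + e^{f_σ} e^{−β ξ_k(θ)})`. -/
theorem trace_exp_spinTwist_mul_gibbsWeight_dGamma_twistedOneBody (β : ℝ) (θ2 : Fin 2 → ℝ) (f : Fin 2 → ℂ) :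
    (NormedSpace.exp (∑ σ : Fin 2, f σ • ∑ x : FermionTorus 2 L, numberAt (orb x σ)) *
        gibbsWeight β (dGamma (twistedOneBody L θ2 0))).trace =
      ∏ k : TorusSite 2 L, ∏ σ : Fin 2,
        (1 + Complex.exp (f σ) * ((Real.exp (-(β * twistedBand L θ2 0 k)) : ℝ) : ℂ)) := by
  set D : Matrix (Orb (FermionTorus 2 L)) (Orb (FermionTorus 2 L)) ℂ := diagonal fun o => f (ofLex o).2 with hDdef
  set h : Matrix (Orb (FermionTorus 2 L)) (Orb (FermionTorus 2 L)) ℂ := twistedOneBody L θ2 0 with hh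
  set F : Matrix (Orb (FermionTorus 2 L)) (Orb (FermionTorus 2 L)) ℂ := planeWaveMatrix 2 L with hF
  set ξ : Orb (FermionTorus 2 L) → ℝ := twistedBandOrb L θ2 0 with hξ
  have hDh : Commute D h := commute_spinDiagonal (twistedOneBody_spin_offdiag θ2 0) f
  have hDF : Commute D F := commute_spinDiagonal planeWaveMatrix_spin_offdiag f
  -- (1) the product of exponentials is `exp (dΓ (D - β h))`
  have hcomm : Commute (dGamma D) (-(β : ℂ) • dGamma h) := (commute_dGamma_of_commute hDh).smul_right _
  have hprod : NormedSpace.exp (∑ σ : Fin 2, f σ • ∑ x : FermionTorus 2 L, numberAt (orb x σ)) * gibbsWeight β (dGamma h) =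
      NormedSpace.exp (dGamma (D - (β : ℂ) • h)) := by
    rw [sum_smul_spinNumber_eq_dGamma_decEq, gibbsWeight, ← Matrix.exp_add_of_commute _ _ hcomm, ← dGamma_smul, ← dGamma_add,
      neg_smul, ← sub_eq_add_neg]
  -- (2) `D - β h = F diag(d) F⋆`
  have hFF : F * star F = 1 := by rw [star_eq_conjTranspose]; exact planeWaveMatrix_mul_conjTranspose
  set d : Orb (FermionTorus 2 L) → ℂ := fun o => f (ofLex o).2 - (β : ℂ) * ((ξ o : ℝ) : ℂ) with hd
  have hX : D - (β : ℂ) • h = F * diagonal d * star F := by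
    have h1 : D = F * D * star F := by rw [← hDF.eq, Matrix.mul_assoc, hFF, Matrix.mul_one]
    have h2 : h = F * diagonal (fun o => ((ξ o : ℝ) : ℂ)) * star F := by
      rw [star_eq_conjTranspose]; exact twistedOneBody_eq_conj θ2 0
    have h3 : diagonal d = D - (β : ℂ) • diagonal (fun o => ((ξ o : ℝ) : ℂ)) := by
      rw [hDdef, ← diagonal_smul, ← diagonal_sub]
      rfl
    rw [h3, Matrix.mul_sub, Matrix.sub_mul, ← h1, Matrix.mul_smul, Matrix.smul_mul, ← h2]
  -- (3) the trace formula for a unitarily diagonalised one-body matrix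
  have htrace := trace_exp_dGamma_unitary_conj_diagonal_decEq ⟨F, planeWaveMatrix_mem_unitaryGroup⟩ d
  simp only at htrace
  rw [hprod, hX, htrace]
  -- (4) `det (1 + F diag(e^d) F⋆) = ∏_o (1 + e^{d_o})`
  have hFinv : F⁻¹ = star F := Matrix.inv_eq_right_inv hFF
  have hFunit : IsUnit F := (Matrix.isUnit_iff_isUnit_det _).mpr (Matrix.isUnit_det_of_right_inverse hFF)
  have hexp : NormedSpace.exp (F * diagonal d * star F) = F * diagonal (fun o => Complex.exp (d o)) * star F := by
    rw [← hFinv, Matrix.exp_conj _ _ hFunit, Matrix.exp_diagonal]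
    congr 2
    funext o
    rw [Pi.exp_def, Complex.exp_eq_exp_ℂ]
  have h1 : 1 + F * diagonal (fun o => Complex.exp (d o)) * star F =
      F * (1 + diagonal fun o => Complex.exp (d o)) * F⁻¹ := by
    rw [hFinv, Matrix.mul_add, Matrix.add_mul, Matrix.mul_one, hFF]
  rw [hexp, h1, Matrix.det_conj hFunit, ← diagonal_one, diagonal_add, det_diagonal, prod_orb_eq_prod_prod]
  -- (5) read the diagonal off: `d_{(x,σ)} = f_σ − β ξ_x`
  refine Fintype.prod_equiv FermionTorus.equivTorusSite _ _ fun x => ?_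
  change _ = ∏ σ : Fin 2, (1 + Complex.exp (f σ) * ((Real.exp (-(β * twistedBand L θ2 0 x.toTorusSite)) : ℝ) : ℂ))
  refine Finset.prod_congr rfl fun σ _ => ?_
  simp only [hd, hξ, twistedBandOrb, ofLex_orb]
  rw [Complex.ofReal_exp, ← Complex.exp_add]
  congr 2
  push_cast
  ring

end StubOneProof

end Summit.Ventures.CertifiedManyBodySolver.Theorems.FreeGasArc

end
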